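import Summits.CriticalPhenomena.PercolationContinuityZ3.Theorems.Transplant.SkelPhiQStepSelection
import HarnessLib

/-!
# Quasi-step SELECTION, III: GEODESIC POINTERS — a suffix-consistent selection with finite closures (the tails-compatible form the ray kits need)

builds on p205010 (kernel theorem, internal audit signed; external expert review pending) — nothing in this file uses p205010 and nothing here is a
percolation statement or a claim about any node.  Lane `prim-bschramm`, seat `prim-bschramm-p5` gen 30 (refuter / sharpness seat; planning memo
HOME/prim-bschramm-p5-g30/Q3-R1.md §4, risk R3).  Helper file (`--supports stmt-CriticalPhenomena-4575 --as helper`).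

WHY.  File I («SkelPhiQStepSelection») selects target WALKS with finite closures (the hull-finiteness risk R1).  The ray kits of a strictness port also
need the TAILS clause of «PlanarSkeletonFrmScaledRayEsc» `exists_rayWalk` (the tail of a ray above ANY of its vertices stays in every up-closed set
containing that vertex), which asks the selection to be SUFFIX-CONSISTENT: the walk chosen at an interior vertex is the rest of the walk through it.  This
holds automatically when the selection is given by POINTERS `nx i v` — one neighbour per vertex and direction, strictly closer to the target — and the
walks are the pointer chains.  This file proves that GEODESIC pointers with finite closures exist, by the same potential argument as file I: along a
geodesic the potential `pd 0 + pd 1` does not increase; at a support vertex of equal potential the pointer BACK along the geodesic is geodesic for the other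
target (`back_snd`), so the core piece closes up; smaller potential is the induction hypothesis; first-piece-wins patching keeps 'geodesic pointer'
pointwise (`exists_pextend`); enumeration patching gives the global pointers (`exists_goodPtr`).  Pointer chains have length exactly `pd ≤ m`.
[cite: AizenmanGrimmett1991, §2 (finite regions)] [cite: KozmaNitzan2024, §4 p. 19 (Step III)]
-/

noncomputable section

namespace Summit.CriticalPhenomena.PercolationContinuityZ3.Theorems.Transplant

namespace Skelφ

namespace QSel

open SimpleGraph
open scoped Classical

variable {V : Type} {H : SimpleGraph V} {P : Fin 2 → Set V} {m : ℕ}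

/-! ## §1 Geodesic pointers: forward and backward -/

/-- Distance zero means being in the target. [folklore] -/
theorem pd_eq_zero_iff (hJ : Joined H P m) (i : Fin 2) (v : V) : pd hJ i v = 0 ↔ v ∈ P i := by
  constructor
  · intro h
    obtain ⟨u, hu, p, hp⟩ := pd_spec hJ i v
    rw [h] at hp
    rw [Walk.eq_of_length_eq_zero hp]; exact hu
  · intro hv
    have := pd_le_length hJ i hv (Walk.nil : H.Walk v v)
    rw [Walk.length_nil] at this; omega

/-- **The FORWARD pointer**: the second vertex of a geodesic is a neighbour one step closer to the target. [folklore] -/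
theorem geo_snd (hJ : Joined H P m) {i : Fin 2} {v : V} {w : Σ u, H.Walk v u} (hw : IsGeo hJ i v w) (h : pd hJ i v ≠ 0) :
    H.Adj v w.2.snd ∧ pd hJ i w.2.snd + 1 = pd hJ i v := by
  have hnil : ¬ w.2.Nil := fun hn => h (hw.2 ▸ Walk.length_eq_zero_iff.mpr hn)
  refine ⟨w.2.adj_snd hnil, ?_⟩
  have h1 : pd hJ i w.2.snd ≤ w.2.tail.length := pd_le_length hJ i hw.1 _
  have h2 := Walk.length_tail_add_one hnil
  have h3 : pd hJ i v ≤ 1 + pd hJ i w.2.snd := by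
    have := pd_le_length_add hJ i (Walk.cons (w.2.adj_snd hnil) Walk.nil)
    rwa [Walk.length_cons, Walk.length_nil] at this
  rw [hw.2] at h2; omega

/-- The second vertex lies on the walk. [folklore] -/
theorem snd_mem_support {v u : V} (p : H.Walk v u) : p.snd ∈ p.support := p.getVert_mem_support 1

/-- **The BACKWARD pointer**: at a support vertex `x ≠ v` of an `i`-geodesic of `v` with the same potential as `v`, the vertex just before `x` on the
geodesic is a neighbour one step closer to the OTHER target (the back-walk of file I is a geodesic; this is its first step). [this work] -/
theorem back_snd (hJ : Joined H P m) {i : Fin 2} {v : V} {w : Σ u, H.Walk v u} (hw : IsGeo hJ i v w) {x : V} (hx : x ∈ w.2.support)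
    (hS : S hJ x = S hJ v) (hxv : x ≠ v) :
    H.Adj x (w.2.takeUntil x hx).reverse.snd ∧
      pd hJ (other i) (w.2.takeUntil x hx).reverse.snd + 1 = pd hJ (other i) x := by
  set p := (w.2.takeUntil x hx).reverse with hp
  have hnil : ¬ p.Nil := Walk.not_nil_of_ne hxv
  refine ⟨p.adj_snd hnil, ?_⟩
  have hδ : pd hJ (other i) x = (w.2.takeUntil x hx).length + pd hJ (other i) v := by
    rw [S_eq hJ i x, S_eq hJ i v] at hS
    have := pd_add_eq_of_geo hJ hw hx; have := pd_le_of_mem_support hJ (other i) w.2 hx; omega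
  have h1 : pd hJ (other i) p.snd ≤ p.tail.length + pd hJ (other i) v := pd_le_length_add hJ _ p.tail
  have h2 := Walk.length_tail_add_one hnil
  have hlen : p.length = (w.2.takeUntil x hx).length := Walk.length_reverse _
  have h3 : pd hJ (other i) x ≤ 1 + pd hJ (other i) p.snd := by
    have := pd_le_length_add hJ (other i) (Walk.cons (p.adj_snd hnil) Walk.nil)
    rwa [Walk.length_cons, Walk.length_nil] at this
  omega

/-! ## §2 Partial pointer selections and the extension lemma -/

/-- **A partial pointer selection**: on a finite domain, for each direction a neighbour strictly closer to the target (at target vertices the pointer is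
junk and never followed). [this work] -/
structure PPSel (hJ : Joined H P m) where
  /-- the domain -/
  dom : Finset V
  /-- the pointers -/
  nx : Fin 2 → V → V
  /-- geodesic pointers on the domain -/
  good : ∀ i, ∀ v ∈ dom, pd hJ i v ≠ 0 → H.Adj v (nx i v) ∧ pd hJ i (nx i v) + 1 = pd hJ i v

namespace PPSel

variable {hJ : Joined H P m}

/-- Extension: larger domain, same pointers on the old domain. [this work] -/
def LE (Q Q' : PPSel hJ) : Prop := Q.dom ⊆ Q'.dom ∧ ∀ i, ∀ v ∈ Q.dom, Q'.nx i v = Q.nx i v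

/-- Reflexivity. [folklore] -/
theorem le_refl (Q : PPSel hJ) : Q.LE Q := ⟨subset_rfl, fun _ _ _ => rfl⟩

/-- Transitivity. [folklore] -/
theorem LE.trans {Q Q' Q'' : PPSel hJ} (h : Q.LE Q') (h' : Q'.LE Q'') : Q.LE Q'' :=
  ⟨h.1.trans h'.1, fun i v hv => (h'.2 i v (h.1 hv)).trans (h.2 i v hv)⟩

/-- Closed: followed pointers stay in the domain. [this work] -/
def Closed (Q : PPSel hJ) : Prop := ∀ i, ∀ v ∈ Q.dom, pd hJ i v ≠ 0 → Q.nx i v ∈ Q.dom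

/-- Relatively closed: the pointers of the NEW vertices stay in the new domain. [this work] -/
def RelClosed (Q Q' : PPSel hJ) : Prop := ∀ i, ∀ v ∈ Q'.dom, v ∉ Q.dom → pd hJ i v ≠ 0 → Q'.nx i v ∈ Q'.dom

/-- A relatively closed extension of a closed partial selection is closed. [this work] -/
theorem closed_of_relClosed {Q Q' : PPSel hJ} (hQ : Q.Closed) (hle : Q.LE Q') (hrel : RelClosed Q Q') : Q'.Closed := by
  intro i v hv h
  by_cases hvQ : v ∈ Q.dom
  · rw [hle.2 i v hvQ]; exact hle.1 (hQ i v hvQ h)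
  · exact hrel i v hv hvQ h

/-- Add one vertex with prescribed pointers. [this work] -/
def insert (Q : PPSel hJ) (v : V) (w : Fin 2 → V) (hw : ∀ i, pd hJ i v ≠ 0 → H.Adj v (w i) ∧ pd hJ i (w i) + 1 = pd hJ i v) :
    PPSel hJ where
  dom := Insert.insert v Q.dom
  nx i := Function.update (Q.nx i) v (w i)
  good i x hx h := by
    by_cases hxv : x = v
    · subst hxv; rw [Function.update_self]; exact hw i h
    · rw [Function.update_of_ne hxv]; exact Q.good i x ((Finset.mem_insert.mp hx).resolve_left hxv) h

/-- Inserting a new vertex is an extension. [folklore] -/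
theorem le_insert (Q : PPSel hJ) {v : V} (hv : v ∉ Q.dom) (w : Fin 2 → V)
    (hw : ∀ i, pd hJ i v ≠ 0 → H.Adj v (w i) ∧ pd hJ i (w i) + 1 = pd hJ i v) : Q.LE (Q.insert v w hw) :=
  ⟨Finset.subset_insert _ _, fun _ x hx => Function.update_of_ne (show x ≠ v from fun h => hv (h ▸ hx)) _ _⟩

/-- The inserted vertex carries the prescribed pointers. [folklore] -/
theorem insert_nx_self (Q : PPSel hJ) (v : V) (w : Fin 2 → V)
    (hw : ∀ i, pd hJ i v ≠ 0 → H.Adj v (w i) ∧ pd hJ i (w i) + 1 = pd hJ i v) (i : Fin 2) : (Q.insert v w hw).nx i v = w i := by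
  show Function.update (Q.nx i) v (w i) v = w i; exact Function.update_self _ _ _

/-- Membership in the enlarged domain. [folklore] -/
theorem mem_insert_dom_iff (Q : PPSel hJ) (v : V) (w : Fin 2 → V)
    (hw : ∀ i, pd hJ i v ≠ 0 → H.Adj v (w i) ∧ pd hJ i (w i) + 1 = pd hJ i v) {x : V} :
    x ∈ (Q.insert v w hw).dom ↔ x = v ∨ x ∈ Q.dom := Finset.mem_insert

end PPSel

open PPSel in
/-- **THE POINTER EXTENSION LEMMA**: every partial pointer selection extends, relatively closed, to one containing any given vertex — strong induction on the
potential; the new vertex points along two geodesics; a support vertex of smaller potential is served by the induction hypothesis, one of equal potential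
points forward along its geodesic and BACKWARD along it for the other target (first piece wins). [this work] -/
theorem exists_pextend (hJ : Joined H P m) (s : ℕ) :
    ∀ v, S hJ v ≤ s → ∀ Q : PPSel hJ, ∃ Q' : PPSel hJ, Q.LE Q' ∧ v ∈ Q'.dom ∧ RelClosed Q Q' := by
  induction s using Nat.strong_induction_on with
  | _ s ih =>
  intro v hvs Q
  by_cases hvQ : v ∈ Q.dom
  · exact ⟨Q, le_refl _, hvQ, fun i x hx hxQ => (hxQ hx).elim⟩
  have hgeo : ∀ i, ∃ w : Σ u, H.Walk v u, IsGeo hJ i v w := fun i => exists_geo hJ i v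
  choose w hw using hgeo
  have hwgood : ∀ i, pd hJ i v ≠ 0 → H.Adj v (w i).2.snd ∧ pd hJ i (w i).2.snd + 1 = pd hJ i v := fun i h => geo_snd hJ (hw i) h
  set Q₁ := Q.insert v (fun i => (w i).2.snd) hwgood with hQ₁
  have hle₁ : Q.LE Q₁ := Q.le_insert hvQ _ hwgood
  let T : Set V := {y | y ∈ (w 0).2.support ∨ y ∈ (w 1).2.support}
  have hTi : ∀ i, ∀ y ∈ (w i).2.support, y ∈ T := by
    intro i y hy
    rcases Fin.exists_fin_two.mp ⟨i, rfl⟩ with h | h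
    · exact Or.inl (h ▸ hy)
    · exact Or.inr (h ▸ hy)
  let Inv : PPSel hJ → Prop := fun R => ∀ i, ∀ x ∈ R.dom, x ∉ Q.dom → pd hJ i x ≠ 0 → R.nx i x ∈ R.dom ∨ R.nx i x ∈ T
  have hInv₁ : Inv Q₁ := by
    intro i x hx hxQ h
    have hxv : x = v := ((Q.mem_insert_dom_iff v _ hwgood).mp hx).resolve_right hxQ
    subst hxv
    rw [hQ₁, Q.insert_nx_self]
    exact Or.inr (hTi i _ (snd_mem_support _))
  have hserve : ∀ (R : PPSel hJ), Q₁.LE R → Inv R → ∀ x, x ∈ T → x ∉ R.dom → ¬ S hJ x < s →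
      ∃ R' : PPSel hJ, R.LE R' ∧ x ∈ R'.dom ∧ Inv R' := by
    intro R hR hIR x hxT hxR hSx
    have hxi : ∃ i, x ∈ (w i).2.support := by
      rcases hxT with h | h
      · exact ⟨0, h⟩
      · exact ⟨1, h⟩
    obtain ⟨i, hxi⟩ := hxi
    have hSle : S hJ x ≤ S hJ v := S_le_of_geo hJ (hw i) hxi
    have hSeq : S hJ x = S hJ v := by omega
    have hxv : x ≠ v := fun h => hxR (h ▸ hR.1 (Finset.mem_insert_self _ _))
    -- forward along the tail of the geodesic, backward along its head
    let w' : Fin 2 → V := fun j => if j = i then ((w i).2.dropUntil x hxi).snd else ((w i).2.takeUntil x hxi).reverse.snd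
    have hw'i : w' i = ((w i).2.dropUntil x hxi).snd := by simp only [w', if_pos rfl]
    have hw'o : ∀ j, j ≠ i → w' j = ((w i).2.takeUntil x hxi).reverse.snd := fun j hj => by simp only [w', if_neg hj]
    have hw'good : ∀ j, pd hJ j x ≠ 0 → H.Adj x (w' j) ∧ pd hJ j (w' j) + 1 = pd hJ j x := by
      intro j h
      by_cases hj : j = i
      · subst hj; rw [hw'i]; exact geo_snd hJ (isGeo_dropUntil hJ (hw j) hxi) h
      · rw [hw'o j hj, eq_other_of_ne hj]; exact back_snd hJ (hw i) hxi hSeq hxv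
    have hw'T : ∀ j, w' j ∈ T := by
      intro j
      by_cases hj : j = i
      · subst hj; rw [hw'i]
        exact hTi j _ ((w j).2.support_dropUntil_subset_support hxi (snd_mem_support _))
      · rw [hw'o j hj]
        refine hTi i _ ((w i).2.support_takeUntil_subset_support hxi ?_)
        have := snd_mem_support ((w i).2.takeUntil x hxi).reverse
        rwa [Walk.support_reverse, List.mem_reverse] at this
    refine ⟨R.insert x w' hw'good, R.le_insert hxR w' hw'good, Finset.mem_insert_self _ _, ?_⟩
    intro j y hy hyQ h
    rcases (R.mem_insert_dom_iff x w' hw'good).mp hy with rfl | hyR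
    · rw [R.insert_nx_self]; exact Or.inr (hw'T j)
    · rw [(R.le_insert hxR w' hw'good).2 j y hyR]
      rcases hIR j y hyR hyQ h with h' | h'
      · exact Or.inl ((R.le_insert hxR w' hw'good).1 h')
      · exact Or.inr h'
  have hlist : ∀ L : List V, (∀ x ∈ L, x ∈ T) → ∀ R : PPSel hJ, Q₁.LE R → Inv R →
      ∃ R' : PPSel hJ, R.LE R' ∧ (∀ x ∈ L, x ∈ R'.dom) ∧ Inv R' := by
    intro L
    induction L with
    | nil => intro _ R _ hIR; exact ⟨R, le_refl _, fun x hx => (List.not_mem_nil hx).elim, hIR⟩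
    | cons x L ihL =>
      intro hL R hR hIR
      have hxT : x ∈ T := hL x List.mem_cons_self
      have hL' : ∀ y ∈ L, y ∈ T := fun y hy => hL y (List.mem_cons_of_mem x hy)
      have hx : ∃ R₂ : PPSel hJ, R.LE R₂ ∧ x ∈ R₂.dom ∧ Inv R₂ := by
        by_cases hxR : x ∈ R.dom
        · exact ⟨R, le_refl _, hxR, hIR⟩
        by_cases hSx : S hJ x < s
        · obtain ⟨R₂, hle₂, hx₂, hrel₂⟩ := ih (S hJ x) hSx x (Nat.le_refl _) R
          refine ⟨R₂, hle₂, hx₂, fun j y hy hyQ h => ?_⟩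
          by_cases hyR : y ∈ R.dom
          · rw [hle₂.2 j y hyR]
            rcases hIR j y hyR hyQ h with h' | h'
            · exact Or.inl (hle₂.1 h')
            · exact Or.inr h'
          · exact Or.inl (hrel₂ j y hy hyR h)
        · exact hserve R hR hIR x hxT hxR hSx
      obtain ⟨R₂, hle₂, hx₂, hI₂⟩ := hx
      obtain ⟨R₃, hle₃, hL₃, hI₃⟩ := ihL hL' R₂ (hR.trans hle₂) hI₂
      exact ⟨R₃, hle₂.trans hle₃, fun y hy => by
        rcases List.mem_cons.mp hy with rfl | hy
        · exact hle₃.1 hx₂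
        · exact hL₃ y hy, hI₃⟩
  obtain ⟨R, hleR, hLR, hIR⟩ := hlist ((w 0).2.support ++ (w 1).2.support)
    (fun x hx => by
      rcases List.mem_append.mp hx with h | h
      · exact Or.inl h
      · exact Or.inr h) Q₁ (le_refl _) hInv₁
  have hTR : ∀ y ∈ T, y ∈ R.dom := fun y hy => hLR y (List.mem_append.mpr hy)
  refine ⟨R, hle₁.trans hleR, hleR.1 (Finset.mem_insert_self _ _), fun i x hx hxQ h => ?_⟩
  rcases hIR i x hx hxQ h with h' | h'
  · exact h'
  · exact hTR _ h'

/-! ## §3 The global pointers -/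

/-- The empty partial pointer selection. [this work] -/
def PPSel.empty (hJ : Joined H P m) : PPSel hJ where
  dom := ∅
  nx _ v := v
  good _ v hv := (Finset.notMem_empty v hv).elim

/-- The stages of the enumeration patching. [this work] -/
def pstage (hJ : Joined H P m) (e : ℕ → V) : ℕ → PPSel hJ
  | 0 => PPSel.empty hJ
  | n + 1 => Classical.choose (exists_pextend hJ (S hJ (e n)) (e n) le_rfl (pstage hJ e n))

/-- The defining property of the successor stage. [this work] -/
theorem pstage_succ_spec (hJ : Joined H P m) (e : ℕ → V) (n : ℕ) :
    (pstage hJ e n).LE (pstage hJ e (n + 1)) ∧ e n ∈ (pstage hJ e (n + 1)).dom ∧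
      PPSel.RelClosed (pstage hJ e n) (pstage hJ e (n + 1)) :=
  Classical.choose_spec (exists_pextend hJ (S hJ (e n)) (e n) le_rfl (pstage hJ e n))

/-- Every stage is closed. [this work] -/
theorem pstage_closed (hJ : Joined H P m) (e : ℕ → V) : ∀ n, (pstage hJ e n).Closed
  | 0 => fun _ v hv => (Finset.notMem_empty v hv).elim
  | n + 1 => PPSel.closed_of_relClosed (pstage_closed hJ e n) (pstage_succ_spec hJ e n).1 (pstage_succ_spec hJ e n).2.2

/-- The stages increase. [this work] -/
theorem pstage_mono (hJ : Joined H P m) (e : ℕ → V) {n k : ℕ} (h : n ≤ k) : (pstage hJ e n).LE (pstage hJ e k) := by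
  induction h with
  | refl => exact PPSel.le_refl _
  | step _ ih => exact ih.trans (pstage_succ_spec hJ e _).1

/-- **The global pointers** along an enumeration with a right inverse: those of the first stage containing the vertex. [this work] -/
def gnx (hJ : Joined H P m) (e : ℕ → V) (g : V → ℕ) (i : Fin 2) (v : V) : V := (pstage hJ e (g v + 1)).nx i v

/-- The `g v + 1`-st stage contains `v`. [this work] -/
theorem mem_pstage_dom (hJ : Joined H P m) {e : ℕ → V} {g : V → ℕ} (hg : ∀ v, e (g v) = v) (v : V) :
    v ∈ (pstage hJ e (g v + 1)).dom := by
  have := (pstage_succ_spec hJ e (g v)).2.1; rwa [hg] at this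

/-- The global pointers agree with every stage containing the vertex. [this work] -/
theorem gnx_eq_of_mem (hJ : Joined H P m) {e : ℕ → V} {g : V → ℕ} (hg : ∀ v, e (g v) = v) {k : ℕ} {v : V}
    (hk : v ∈ (pstage hJ e k).dom) (i : Fin 2) : gnx hJ e g i v = (pstage hJ e k).nx i v := by
  unfold gnx
  rcases le_total (g v + 1) k with h | h
  · exact ((pstage_mono hJ e h).2 i v (mem_pstage_dom hJ hg v)).symm
  · exact (pstage_mono hJ e h).2 i v hk

variable (H P m) in
/-- **Good pointers**: geodesic pointers at every vertex off the targets, all closures under "follow either pointer" finite. [this work] -/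
def GoodPtr (hJ : Joined H P m) (nx : Fin 2 → V → V) : Prop :=
  (∀ i v, pd hJ i v ≠ 0 → H.Adj v (nx i v) ∧ pd hJ i (nx i v) + 1 = pd hJ i v) ∧
    ∀ v, {x | Relation.ReflTransGen (fun a b => ∃ i, pd hJ i a ≠ 0 ∧ b = nx i a) v x}.Finite

/-- **THE POINTER SELECTION LEMMA** (abstract form): on a countable vertex type, if every vertex is joined to each of two targets within length `m`,
there are GEODESIC POINTERS at every vertex (a neighbour one step closer to the target) such that every closure under "follow either pointer" is FINITE.
The pointer chain from `v` to the target `P i` has length exactly `pd i v ≤ m`, and the chain from any of its vertices is its tail (suffix-consistency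
for free). [this work] -/
theorem exists_goodPtr [Countable V] (hJ : Joined H P m) : ∃ nx : Fin 2 → V → V, GoodPtr H P m hJ nx := by
  rcases isEmpty_or_nonempty V with hV | hV
  · exact ⟨fun _ v => v, fun _ v => isEmptyElim v, fun v => isEmptyElim v⟩
  obtain ⟨e, he⟩ := exists_surjective_nat V
  choose g hg using he
  refine ⟨gnx hJ e g, fun i v h => ?_, fun v => (pstage hJ e (g v + 1)).dom.finite_toSet.subset ?_⟩
  · have := (pstage hJ e (g v + 1)).good i v (mem_pstage_dom hJ hg v) h
    rwa [← gnx_eq_of_mem hJ hg (mem_pstage_dom hJ hg v)] at this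
  · intro x hx
    induction hx with
    | refl => exact mem_pstage_dom hJ hg v
    | tail _ hbc ih =>
      obtain ⟨i, hi, rfl⟩ := hbc
      rw [gnx_eq_of_mem hJ hg ih i]
      exact pstage_closed hJ e _ i _ ih hi

end QSel

end Skelφ

end Summit.CriticalPhenomena.PercolationContinuityZ3.Theorems.Transplant

end
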